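import Literature.LinearAlgebra.Matrix.AdjointSU3Orthogonal
import Literature.LinearAlgebra.Matrix.SimultaneousConjugacyProducts
import Literature.MathematicalPhysics.QuantumFieldTheory.Balaban1983to89.TraceWordsSeparateOrbitsOrthogonal
import HarnessLib

/-!
# CENSUS NEGATIVE FOR `SO(8)`: word-wise conjugacy does NOT imply simultaneous conjugacy — trace words in EVERY
# representation fail to separate orbits; [Sengupta1994] Thm 2's conclusion and [Levy2004] Prop. 3.4 fail at `G = SO(8)`
# (mechanism of [Sikora2017] Thm «undisting», here via `Ad : U(3) → SO(8)`)

statement-level skeleton of published theorems with citation tags; proofs where landed; nothing here is a claim about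
the Yang–Mills mass gap

Cell `lit-balaban`, unit p24 gen 20 (own-lane free target of the Lie ∕ linear-algebra lineage, G.5-34(d); no SKELETON
row).  Companion of the lineage's orbit-separation census for module XXI's schema
`TraceWordsSeparateOrbits ρ` (`InfiniteVolumeSufficientXXI`): TRUE for `U(N)`, `SU(N)` (p331019), `O(N)`, `SO(2m+1)`
(p336810), `Sp(n)` and every `G_J` (p339951); FALSE for the NATURAL representation of `SO(2m)` (p340120, reflection-conjugate
tuples: the polarized Pfaffian separates them).  The natural question left open there — recorded as HONEST SCOPE «Lévy's
Thm 3.1 with ALL representations not formalised» — is whether passing to ALL finite-dimensional representations of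
`SO(2m)` (equivalently: to conjugacy IN `SO(2m)` of every word, i.e. to all class functions of the words) restores orbit
separation, as [Levy2004] Prop. 3.4 / Thm 3.1 assert for `SO(n)`.  THIS FILE PROVES THAT IT DOES NOT, for `SO(8)`:

* §1 two matrix lemmas in even dimension: an orthogonal `R` with `det R = −1` has a non-zero FIXED vector when the
  dimension is even (`det(R − 1) = det R · det(1 − R)`), and the Householder REFLECTION `1 − 2vvᵀ/⟨v,v⟩` in a vector
  fixed by an orthogonal `x` is an orthogonal matrix of determinant `−1` commuting with `x`;
* §2 the families.  `adSO8 : U(3) →* SO(8)` is the adjoint representation on `𝔰𝔲(3) ≅ ℝ⁸`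
  (`Literature/LinearAlgebra/Matrix/AdjointSU3Orthogonal.lean`); `Q` = the reflection in `e₀` (`det Q = −1`);
  `V h = Ad h`, `W h = Q (Ad h) Q`.  **Every word — indeed every element `Ad h` of the image — satisfies
  `W h = y (V h) y⁻¹` with `y ∈ SO(8)`** (`exists_conj_eq`: `y = Q r_v`, `r_v` the reflection in a fixed vector `v` of
  `Ad h`, which exists by `AdjointSU3Orthogonal.exists_ne_zero_mulVec_eq`), **but NO `y ∈ SO(8)` conjugates `V` to `W`
  simultaneously** (`not_exists_simultaneous_conj`: `Q y` would commute with the irreducible `Ad(U(3))`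
  (`AdjointSU3Orthogonal.eq_bot_or_eq_top_of_forall_mulVec_mem`), its fixed space — non-zero as `det(Qy) = −1` and `8`
  is even — would be invariant, hence everything, so `Qy = 1`, contradicting `det = −1`).  This is A. S. Sikora's
  argument [Sikora2017, §2, proof of Thm «undisting»] with his `SO(5) → SO(14)` (on `Sym²ℂ⁵ ⊖ ℂ`) replaced by
  `Ad : U(3) → SO(8)`; Sikora's printed range is `SO(2n, ℂ)`, `n ≥ 7`, `n ≠ 8` — the present `n = 4` instance is not
  among his printed cases (his route through the Pfaffian-type invariant `Q_{2n}` needs a different bookkeeping; in the compact real setting a single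
  fixed vector suffices because fixed vectors of real orthogonal matrices are never isotropic);
* §3 **`¬ ProdConjDetermined SO(8)`** (`not_prodConjDetermined_specialOrthogonalGroup_eight`): the conclusion of
  [Sengupta1994] Theorem 2 — «if every product `g_{a₁}⋯g_{a_k}` is conjugate in `G` to `g'_{a₁}⋯g'_{a_k}` then the
  families are simultaneously conjugate», the tree's `Literature.LinearAlgebra.Matrix.ProdConjDetermined` of p334319 —
  FAILS for `G = SO(8)` (Sengupta's printed list «abelian groups, the unitary groups U(n), special unitary groups SU(n),
  orthogonal groups O(n), and the odd special orthogonal groups SO(2n+1)» rightly omits the even special orthogonal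
  groups); by compactness of `SO(8)` a FINITE sub-family already fails (`exists_finset_not_simultaneous_conj`);
* §4 **for EVERY finite-dimensional representation `ρ : SO(8) →* M_N(ℂ)` (any `N`, continuity not needed),
  `¬ TraceWordsSeparateOrbits ρ`** (`not_traceWordsSeparateOrbits_specialOrthogonalGroup_eight`) — the same finite
  pair of families has equal word traces in ALL representations at once (`tracePart_wordVal_eq`), in particular in the
  natural one (`…_specialOrthogonalRep_eight`, a second proof of the `N = 8` case of p340120) — and the shape of
  [Levy2004] Prop. 3.4 fails for `SO(8)`: there are `r` and `g, g' ∈ SO(8)^r` with `w(g)` and `w(g')` conjugate in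
  `SO(8)` for every word `w` but `g, g'` in different diagonal conjugacy classes
  (`exists_wordwise_conj_not_simultaneous_conj`).  Consequently Wilson loops in all representations do not separate the
  gauge orbits of an `SO(8)` lattice gauge field on the bouquet `L_r`, against [Levy2004] Thm 3.1's `SO(n)` clause at
  `n = 8` (Prop. 3.6 there: Thm 3.1 ⟺ Prop. 3.4); we record the discrepancy, we do not resolve it beyond the kernel
  theorem (HOME/GAPS.md G-p24-g20-1).

HONEST SCOPE.  (a) `SO(8)` only (and, by the same construction with any irreducible orthogonal representation of even
dimension all of whose elements have eigenvalue `1`, e.g. `Ad` of `Sp(2)` on `𝔰𝔭(2) ≅ ℝ¹⁰`, other even `N` — not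
done here); `SO(4)`, `SO(6)` are NOT decided by this file (for `SO(2)` the property holds trivially).  (b) Nothing about
torus states or the infinite-volume question of the `InfiniteVolumeSufficient*` series; module XIX's lattice density
statement for `SO(8)` Wilson loops is refuted for the natural representation by p348765 and is not re-derived here for
general `ρ`.  (c) Not a claim about Sikora's algebraic (complex, `SO(8, ℂ)`) character variety, though the same
families are non-conjugate there for the same reason.

## References

* [Sikora2017] A. S. Sikora, *SO(2n,ℂ)-character varieties are not varieties of characters*, J. Algebra 478 (2017)
  195–214: Theorem «undisting» (p.2: «For any n ≥ 7, n ≠ 8, any group Γ projecting onto ℤ_p ∗ ℤ_q … has two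
  non-conjugate irreducible representations into SO(2n,ℂ) which are undistinguishable by the generalized trace
  functions») and its proof, §2 (p.8: `ρ' = MρM⁻¹`, `det M = −1`; eigenvalue `1` of every `ψ(γ)`; «Suppose
  `ρ' = MρM⁻¹` equals `AρA⁻¹`, for some `A ∈ SO(2n,ℂ)`. Then `MA⁻¹` commutes with the image of `ρ`, which by Shur's
  Lemma … Hence, for `n = 7`, `MA⁻¹` is a scalar matrix. The only scalar matrices in `O(2n,ℂ)` are `±I`. That however
  implies that `det(MA⁻¹) = 1` and, hence, `det(A) = det(M) = −1`»).
* [Sengupta1994] A. Sengupta, *Gauge invariant functions of connections*, Proc. AMS 121 (1994) 897–905, Theorem 2 p.900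
  («Let G be a product of groups from the following list: abelian groups, the unitary groups U(n), special unitary
  groups SU(n), orthogonal groups O(n), and the odd special orthogonal groups SO(2n+1)»).
* [Levy2004] T. Lévy, *Wilson loops in the light of spin networks*, J. Geom. Phys. 52 (2004) 382–397, Theorem 3.1 and
  Proposition 3.4 (p.5: `G` «a finite product of groups among U(n), SU(n), O(n), SO(n), Sp(n)»), Prop. 3.6.
* [HornJohnson2013] R. A. Horn, C. R. Johnson, *Matrix Analysis*, 2nd ed., CUP: Example 2.1.12 (Householder matrices) and
  Corollary 2.5.11 (c) (canonical form of real orthogonal matrices) — the two matrix lemmas of §1.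
-/

noncomputable section

open Matrix

universe v

namespace Literature.MathematicalPhysics.QuantumFieldTheory.Balaban1983to89.WilsonLoopsNotCompleteSO8

open Literature.LinearAlgebra.Matrix (ProdConjDetermined prodConjDetermined_iff)
open Literature.LinearAlgebra.Matrix.AdjointSU3Orthogonal (adMatrix adSO8 coe_adSO8 adMatrix_mem_orthogonalGroup
  exists_ne_zero_mulVec_eq eq_bot_or_eq_top_of_forall_mulVec_mem)
open Balaban1983to89.Missing (TraceWordsSeparateOrbits)
open TraceWordsSeparateOrbitsOrthogonal (specialOrthogonalRep)

/-! ## §1 Two matrix lemmas in even dimension -/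

section MatrixLemmas

variable {m : Type*} [Fintype m] [DecidableEq m]

/-- **An orthogonal matrix of determinant `−1` in EVEN dimension has a non-zero fixed vector**: `det(R − 1) = 0`,
because `R − 1 = R(1 − Rᵀ)` gives `det(R − 1) = det R · det(1 − R) = −det(R − 1)`.
[cite: HornJohnson2013, Corollary 2.5.11 (c), (2.5.14) (canonical form `Λ_{n−2p} ⊕ rotations`, `Λ = diag(±1,…,±1)`: in even dimension `det = −1` forces the eigenvalue `+1`); Sikora2017, §2 (proof of Thm «undisting»)] -/
theorem det_sub_one_eq_zero_of_det_eq_neg_one (hm : Even (Fintype.card m)) {R : Matrix m m ℝ}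
    (hR : R ∈ Matrix.orthogonalGroup m ℝ) (hdet : R.det = -1) : (R - 1).det = 0 := by
  have hRRt : R * Rᵀ = 1 := by
    have h := Matrix.mem_unitaryGroup_iff.1 hR
    rwa [Matrix.star_eq_conjTranspose, Matrix.conjTranspose_eq_transpose_of_trivial] at h
  have hfac : R - 1 = R * (1 - Rᵀ) := by rw [Matrix.mul_sub, Matrix.mul_one, hRRt]
  have h1 : (1 - R).det = (R - 1).det := by
    rw [← neg_sub, det_neg, Even.neg_one_pow hm, one_mul]
  have h2 : (R - 1).det = -(R - 1).det := by
    conv_lhs => rw [hfac, det_mul, hdet, ← transpose_one, ← transpose_sub, det_transpose, h1]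
    ring
  linarith

/-- Vector form: such an `R` fixes a non-zero vector. [cite: HornJohnson2013, Corollary 2.5.11 (c), (2.5.14) (canonical form `Λ_{n−2p} ⊕ rotations`, `Λ = diag(±1,…,±1)`: in even dimension `det = −1` forces the eigenvalue `+1`); Sikora2017, §2 (proof of Thm «undisting»)] -/
theorem exists_ne_zero_mulVec_eq_self_of_det_eq_neg_one (hm : Even (Fintype.card m)) {R : Matrix m m ℝ}
    (hR : R ∈ Matrix.orthogonalGroup m ℝ) (hdet : R.det = -1) : ∃ v : m → ℝ, v ≠ 0 ∧ R *ᵥ v = v := by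
  obtain ⟨v, hv, hRv⟩ := Matrix.exists_mulVec_eq_zero_iff.2 (det_sub_one_eq_zero_of_det_eq_neg_one hm hR hdet)
  refine ⟨v, hv, ?_⟩
  rwa [Matrix.sub_mulVec, Matrix.one_mulVec, sub_eq_zero] at hRv

/-- The HOUSEHOLDER REFLECTION in the hyperplane orthogonal to `v`: `r_v = 1 − (2/⟨v,v⟩) v vᵀ`. [cite: HornJohnson2013, Example 2.1.12 (Householder matrices `U_w = I − 2(w*w)⁻¹ww*`)] -/
def reflection (v : m → ℝ) : Matrix m m ℝ := 1 - (2 / (v ⬝ᵥ v)) • Matrix.vecMulVec v v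

omit [Fintype m] [DecidableEq m] in
/-- `c • (v wᵀ) = (c • v) wᵀ`. [folklore] -/
private theorem smul_vecMulVec' (c : ℝ) (v w : m → ℝ) : c • Matrix.vecMulVec v w = Matrix.vecMulVec (c • v) w := by
  ext i j
  simp [Matrix.vecMulVec_apply, mul_assoc]

omit [Fintype m] [DecidableEq m] in
/-- `v (c • w)ᵀ = c • (v wᵀ)`. [folklore] -/
private theorem vecMulVec_smul' (c : ℝ) (v w : m → ℝ) : Matrix.vecMulVec v (c • w) = c • Matrix.vecMulVec v w := by
  ext i j
  simp [Matrix.vecMulVec_apply, mul_left_comm]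

/-- `r_v` is symmetric. [folklore] -/
private theorem transpose_reflection (v : m → ℝ) : (reflection v)ᵀ = reflection v := by
  rw [reflection, transpose_sub, transpose_one, transpose_smul, transpose_vecMulVec]

/-- `r_v² = 1` (`v ≠ 0`). [folklore] -/
private theorem reflection_mul_self {v : m → ℝ} (hv : v ≠ 0) : reflection v * reflection v = 1 := by
  have hvv : v ⬝ᵥ v ≠ 0 := fun h => hv (dotProduct_self_eq_zero.1 h)
  set P : Matrix m m ℝ := Matrix.vecMulVec v v with hP
  set c : ℝ := 2 / (v ⬝ᵥ v) with hc
  have hPP : P * P = (v ⬝ᵥ v) • P := by rw [hP, Matrix.vecMulVec_mul_vecMulVec, vecMulVec_smul']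
  have key : c * c * (v ⬝ᵥ v) = c + c := by rw [hc]; field_simp; ring
  change (1 - c • P) * (1 - c • P) = 1
  rw [sub_mul, one_mul, mul_sub, mul_one, smul_mul_assoc, mul_smul_comm, hPP, smul_smul, smul_smul, key, add_smul]
  abel

/-- **`r_v` is orthogonal** (`v ≠ 0`). [cite: HornJohnson2013, Example 2.1.12, Exercise (real `w ≠ 0`: `U_w` is real orthogonal and symmetric)] -/
theorem reflection_mem_orthogonalGroup {v : m → ℝ} (hv : v ≠ 0) : reflection v ∈ Matrix.orthogonalGroup m ℝ := by
  rw [Matrix.mem_unitaryGroup_iff, Matrix.star_eq_conjTranspose, Matrix.conjTranspose_eq_transpose_of_trivial,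
    transpose_reflection, reflection_mul_self hv]

/-- **`det r_v = −1`** (`v ≠ 0`; matrix determinant lemma). [cite: HornJohnson2013, Example 2.1.12, Exercise (`det U_w = −1` for all `n`, via (0.8.5.11))] -/
theorem det_reflection {v : m → ℝ} (hv : v ≠ 0) : (reflection v).det = -1 := by
  have hvv : v ⬝ᵥ v ≠ 0 := fun h => hv (dotProduct_self_eq_zero.1 h)
  rw [reflection, sub_eq_add_neg, ← neg_smul, smul_vecMulVec', Matrix.vecMulVec_eq Unit,
    Matrix.det_one_add_replicateCol_mul_replicateRow, dotProduct_smul, smul_eq_mul]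
  field_simp
  ring

/-- **An orthogonal matrix fixing `v` commutes with the reflection `r_v`**: `x vvᵀ = (xv)vᵀ = vvᵀ` and
`vvᵀ x = v(xᵀv)ᵀ = vvᵀ` since `xᵀ v = x⁻¹ v = v`. [cite: HornJohnson2013, Example 2.1.12, Exercise (`U_w x = x` for `x ⊥ w`, `U_w w = −w`: so `x U_w x⁻¹ = U_{xw} = U_w` when `xw = w`)] -/
theorem mul_reflection_comm {x : Matrix m m ℝ} (hx : x ∈ Matrix.orthogonalGroup m ℝ) {v : m → ℝ}
    (hxv : x *ᵥ v = v) : x * reflection v = reflection v * x := by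
  have hxtx : xᵀ * x = 1 := by
    have h := Matrix.mem_unitaryGroup_iff'.1 hx
    rwa [Matrix.star_eq_conjTranspose, Matrix.conjTranspose_eq_transpose_of_trivial] at h
  have hxt : xᵀ *ᵥ v = v := by
    conv_lhs => rw [← hxv, Matrix.mulVec_mulVec, hxtx, Matrix.one_mulVec]
  rw [reflection, mul_sub, sub_mul, mul_one, one_mul, mul_smul_comm, smul_mul_assoc, Matrix.mul_vecMulVec, hxv,
    Matrix.vecMulVec_mul, ← Matrix.mulVec_transpose, hxt]

end MatrixLemmas

/-! ## §2 The two families in `SO(8)`: every element word-wise conjugate, no simultaneous conjugator -/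

section Families

/-- `SO(8)` as a type (Mathlib's `Matrix.specialOrthogonalGroup (Fin 8) ℝ`, a group). [folklore] -/
abbrev SO8 : Type := Matrix.specialOrthogonalGroup (Fin 8) ℝ

/-- `U(3)` as a type. [folklore] -/
abbrev U3 : Type := Matrix.unitaryGroup (Fin 3) ℂ

/-- The reflection `Q = r_{e₀} = diag(−1, 1, …, 1)` of `ℝ⁸`, an orthogonal matrix of determinant `−1` (Sikora's
`M ∈ O(2n)`, `det M = −1`). [cite: Sikora2017, §2 (proof of Thm «undisting»)] -/
def Q : Matrix (Fin 8) (Fin 8) ℝ := reflection (Pi.single 0 1)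

/-- `e₀ ≠ 0`. [folklore] -/
private theorem single_ne_zero : (Pi.single (0 : Fin 8) (1 : ℝ) : Fin 8 → ℝ) ≠ 0 := by
  intro h
  have := congrFun h 0
  simp at this

/-- `Q ∈ O(8)`. [cite: Sikora2017, §2 (proof of Thm «undisting»)] -/
theorem Q_mem_orthogonalGroup : Q ∈ Matrix.orthogonalGroup (Fin 8) ℝ := reflection_mem_orthogonalGroup single_ne_zero

/-- `det Q = −1`. [cite: Sikora2017, §2 (proof of Thm «undisting»)] -/
theorem det_Q : Q.det = -1 := det_reflection single_ne_zero

/-- `Q² = 1`. [folklore] -/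
private theorem Q_mul_Q : Q * Q = 1 := reflection_mul_self single_ne_zero

/-- Conjugation by `Q` preserves `SO(8)` (as a set). [folklore] -/
private theorem conj_Q_mem (A : SO8) : Q * (A : Matrix (Fin 8) (Fin 8) ℝ) * Q ∈ Matrix.specialOrthogonalGroup (Fin 8) ℝ := by
  refine Matrix.mem_specialOrthogonalGroup_iff.2 ⟨?_, ?_⟩
  · exact Submonoid.mul_mem _ (Submonoid.mul_mem _ Q_mem_orthogonalGroup (Matrix.mem_specialOrthogonalGroup_iff.1 A.2).1)
      Q_mem_orthogonalGroup
  · rw [det_mul, det_mul, det_Q, (Matrix.mem_specialOrthogonalGroup_iff.1 A.2).2]; norm_num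

/-- **Conjugation by `Q`**, the outer automorphism `A ↦ Q A Q⁻¹ = Q A Q` of `SO(8)` (Sikora's involution `σ`).
[cite: Sikora2017, §2 (proof of Thm «undisting»)] -/
def conjQ : SO8 →* SO8 where
  toFun A := ⟨Q * (A : Matrix (Fin 8) (Fin 8) ℝ) * Q, conj_Q_mem A⟩
  map_one' := Subtype.ext (by simp [Q_mul_Q])
  map_mul' A B := Subtype.ext (by
    change Q * ((A : Matrix (Fin 8) (Fin 8) ℝ) * B) * Q = Q * A * Q * (Q * B * Q)
    calc Q * ((A : Matrix (Fin 8) (Fin 8) ℝ) * B) * Q = Q * A * (Q * Q) * B * Q := by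
          rw [Q_mul_Q, Matrix.mul_one]; simp only [Matrix.mul_assoc]
      _ = Q * A * Q * (Q * B * Q) := by simp only [Matrix.mul_assoc])

/-- Matrix of `conjQ A`. [folklore] -/
@[simp] private theorem coe_conjQ (A : SO8) : ((conjQ A : SO8) : Matrix (Fin 8) (Fin 8) ℝ) = Q * A * Q := rfl

/-- **THE FIRST FAMILY `V = Ad : U(3) → SO(8)`** (Sikora's `ρ`). [cite: Sikora2017, §2 (proof of Thm «undisting»)] -/
def famV : U3 → SO8 := adSO8

/-- **THE SECOND FAMILY `W = Q·Ad·Q⁻¹`** (Sikora's `ρ' = MρM⁻¹`). [cite: Sikora2017, §2 (proof of Thm «undisting»)] -/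
def famW : U3 → SO8 := fun h => conjQ (adSO8 h)

/-- In `SO(8)` (indeed in any matrix group of orthogonal matrices) the group inverse is the transpose; we only need:
`y * A * y⁻¹ = B ↔ y * A = B * y`. [folklore] -/
private theorem conj_eq_iff (y A B : SO8) : B = y * A * y⁻¹ ↔ B * y = y * A := by
  rw [eq_mul_inv_iff_mul_eq]

/-- **EVERY ELEMENT OF THE IMAGE IS CONJUGATE IN `SO(8)` TO ITS `Q`-CONJUGATE**: for `h ∈ U(3)`,
`Q (Ad h) Q = y (Ad h) y⁻¹` with `y = Q · r_v ∈ SO(8)`, `v` a non-zero fixed vector of `Ad h` (Sikora: every `ρ(γ)` has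
eigenvalue `1`; here the reflection in the fixed vector is the determinant-`−1` element of the centraliser).
[cite: Sikora2017, §2 (proof of Thm «undisting»)] -/
theorem exists_conj_eq (h : U3) : ∃ y : SO8, famW h = y * famV h * y⁻¹ := by
  obtain ⟨v, hv, hfix⟩ := exists_ne_zero_mulVec_eq h
  have hr := reflection_mem_orthogonalGroup hv
  have hy : Q * reflection v ∈ Matrix.specialOrthogonalGroup (Fin 8) ℝ := by
    refine Matrix.mem_specialOrthogonalGroup_iff.2 ⟨Submonoid.mul_mem _ Q_mem_orthogonalGroup hr, ?_⟩
    rw [det_mul, det_Q, det_reflection hv]; norm_num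
  refine ⟨⟨Q * reflection v, hy⟩, (conj_eq_iff _ _ _).2 (Subtype.ext ?_)⟩
  change Q * adMatrix h * Q * (Q * reflection v) = Q * reflection v * adMatrix h
  have hcomm := mul_reflection_comm (adMatrix_mem_orthogonalGroup h) hfix
  calc Q * adMatrix h * Q * (Q * reflection v) = Q * adMatrix h * (Q * Q) * reflection v := by
        simp only [Matrix.mul_assoc]
    _ = Q * reflection v * adMatrix h := by rw [Q_mul_Q, Matrix.mul_one, Matrix.mul_assoc, hcomm, ← Matrix.mul_assoc]

/-- Hence EVERY NON-EMPTY PRODUCT along the two families is conjugate in `SO(8)` (the hypothesis of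
`ProdConjDetermined`, i.e. of [Sengupta1994] Thm 2, for `V`, `W` indexed by any map into `U(3)`).
[cite: Sengupta1994, Thm 2 p.900] -/
theorem exists_prod_conj {ι : Type*} (g : ι → U3) (l : List ι) :
    ∃ y : SO8, (l.map (famW ∘ g)).prod = y * (l.map (famV ∘ g)).prod * y⁻¹ := by
  have hV : (l.map (famV ∘ g)).prod = famV (l.map g).prod := by
    rw [famV, ← List.map_map, map_list_prod]
  have hW : (l.map (famW ∘ g)).prod = famW (l.map g).prod := by
    change (l.map ((conjQ.comp adSO8) ∘ g)).prod = (conjQ.comp adSO8) (l.map g).prod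
    rw [← List.map_map, map_list_prod]
  rw [hV, hW]
  exact exists_conj_eq _

/-- **NO ELEMENT OF `SO(8)` CONJUGATES `V` TO `W` SIMULTANEOUSLY**: such a `y` would make `R = Q·y` an orthogonal
matrix of determinant `−1` commuting with `Ad(U(3))`; `R` fixes a non-zero vector (`8` is even), its fixed space is
`Ad(U(3))`-invariant hence all of `ℝ⁸` (irreducibility), so `R = 1` — but `det R = −1` (Sikora: «`MA⁻¹` commutes with
the image of `ρ` … is a scalar matrix … `±I` … `det(MA⁻¹) = 1`»). [cite: Sikora2017, §2 (proof of Thm «undisting»)] -/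
theorem not_exists_simultaneous_conj : ¬ ∃ y : SO8, ∀ h : U3, famW h = y * famV h * y⁻¹ := by
  rintro ⟨y, hy⟩
  have hyO : (y : Matrix (Fin 8) (Fin 8) ℝ) ∈ Matrix.orthogonalGroup (Fin 8) ℝ :=
    (Matrix.mem_specialOrthogonalGroup_iff.1 y.2).1
  set R : Matrix (Fin 8) (Fin 8) ℝ := Q * (y : Matrix (Fin 8) (Fin 8) ℝ) with hR_def
  have hRO : R ∈ Matrix.orthogonalGroup (Fin 8) ℝ := Submonoid.mul_mem _ Q_mem_orthogonalGroup hyO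
  have hRdet : R.det = -1 := by
    rw [hR_def, det_mul, det_Q, (Matrix.mem_specialOrthogonalGroup_iff.1 y.2).2]; norm_num
  -- `R` commutes with every `Ad h`
  have hcomm : ∀ h : U3, R * adMatrix h = adMatrix h * R := fun h => by
    have h1 := congrArg (fun A : SO8 => (A : Matrix (Fin 8) (Fin 8) ℝ)) ((conj_eq_iff _ _ _).1 (hy h))
    change Q * adMatrix h * Q * (y : Matrix (Fin 8) (Fin 8) ℝ) = (y : Matrix (Fin 8) (Fin 8) ℝ) * adMatrix h at h1
    have h2 : adMatrix h * (Q * (y : Matrix (Fin 8) (Fin 8) ℝ)) = Q * (y : Matrix (Fin 8) (Fin 8) ℝ) * adMatrix h := by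
      calc adMatrix h * (Q * (y : Matrix (Fin 8) (Fin 8) ℝ))
          = Q * Q * adMatrix h * (Q * (y : Matrix (Fin 8) (Fin 8) ℝ)) := by rw [Q_mul_Q, Matrix.one_mul]
        _ = Q * (Q * adMatrix h * Q * (y : Matrix (Fin 8) (Fin 8) ℝ)) := by simp only [Matrix.mul_assoc]
        _ = Q * (y : Matrix (Fin 8) (Fin 8) ℝ) * adMatrix h := by rw [h1, ← Matrix.mul_assoc]
    rw [hR_def]
    exact h2.symm
  -- the fixed space of `R` is a non-zero invariant subspace
  obtain ⟨v, hv, hRv⟩ :=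
    exists_ne_zero_mulVec_eq_self_of_det_eq_neg_one (m := Fin 8) (by decide) hRO hRdet
  let F : Submodule ℝ (Fin 8 → ℝ) := LinearMap.ker (Matrix.mulVecLin (R - 1))
  have hF : ∀ u, u ∈ F ↔ R *ᵥ u = u := fun u => by
    change (R - 1) *ᵥ u = 0 ↔ _
    rw [Matrix.sub_mulVec, Matrix.one_mulVec, sub_eq_zero]
  have hFinv : ∀ h : U3, ∀ u ∈ F, adMatrix h *ᵥ u ∈ F := fun h u hu => by
    rw [hF] at hu ⊢
    rw [Matrix.mulVec_mulVec, hcomm h, ← Matrix.mulVec_mulVec, hu]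
  rcases eq_bot_or_eq_top_of_forall_mulVec_mem F hFinv with hbot | htop
  · have : v ∈ F := (hF v).2 hRv
    rw [hbot, Submodule.mem_bot] at this
    exact hv this
  · have hR1 : R = 1 := by
      ext i j
      have hj : R *ᵥ Pi.single j 1 = Pi.single j 1 := (hF _).1 (by rw [htop]; exact Submodule.mem_top)
      have hij := congrFun hj i
      rw [Matrix.mulVec_single_one] at hij
      change R i j = (Pi.single j (1 : ℝ) : Fin 8 → ℝ) i at hij
      rw [hij, Matrix.one_apply, Pi.single_apply]
    rw [hR1, det_one] at hRdet
    norm_num at hRdet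

end Families

/-! ## §3 `ProdConjDetermined SO(8)` is false; a finite sub-family already fails -/

section Sengupta

/-- **[Sengupta1994] THEOREM 2's CONCLUSION FAILS FOR `G = SO(8)`**: `SO(8)` does NOT have the property
`ProdConjDetermined` (p334319: every non-empty positive product conjugate ⟹ simultaneously conjugate), witnessed by
the families `V = Ad`, `W = Q·Ad·Q` indexed by `U(3)` (lifted to any universe).  Sengupta's printed list — abelian,
`U(n)`, `SU(n)`, `O(n)`, `SO(2n+1)` — rightly omits the even special orthogonal groups.
[cite: Sengupta1994, Thm 2 p.900; Sikora2017, Thm «undisting» and §2] -/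
theorem not_prodConjDetermined_specialOrthogonalGroup_eight :
    ¬ ProdConjDetermined.{0, v} (Matrix.specialOrthogonalGroup (Fin 8) ℝ) := by
  intro hP
  have h := (prodConjDetermined_iff _).1 hP (famV ∘ ULift.down.{v}) (famW ∘ ULift.down.{v})
    (fun l _ => exists_prod_conj ULift.down l)
  obtain ⟨y, hy⟩ := h
  exact not_exists_simultaneous_conj ⟨y, fun g => hy ⟨g⟩⟩

/-- The conjugacy condition `W h = y V h y⁻¹` is CLOSED in `y ∈ SO(8)`. [folklore] -/
private theorem isClosed_conjSet (h : U3) : IsClosed {y : SO8 | famW h = y * famV h * y⁻¹} := by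
  have : {y : SO8 | famW h = y * famV h * y⁻¹} = {y : SO8 | famW h * y = y * famV h} := by
    ext y; exact conj_eq_iff _ _ _
  rw [this]
  exact isClosed_eq (continuous_const.mul continuous_id) (continuous_id.mul continuous_const)

/-- **A FINITE SUB-FAMILY ALREADY FAILS** (compactness of `SO(8)`: the closed sets
`{y : W h = y V h y⁻¹}`, `h ∈ U(3)`, have empty intersection, so finitely many of them do).
[cite: Levy2004, Prop 3.5 (compactness argument); Sikora2017, Thm «undisting»] -/
theorem exists_finset_not_simultaneous_conj :
    ∃ s : Finset U3, ¬ ∃ y : SO8, ∀ h ∈ s, famW h = y * famV h * y⁻¹ := by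
  have hK : (Set.univ : Set SO8) ∩ ⋂ h : U3, {y : SO8 | famW h = y * famV h * y⁻¹} = ∅ := by
    rw [Set.univ_inter, Set.eq_empty_iff_forall_notMem]
    intro y hy
    rw [Set.mem_iInter] at hy
    exact not_exists_simultaneous_conj ⟨y, fun h => hy h⟩
  obtain ⟨s, hs⟩ := isCompact_univ.elim_finite_subfamily_closed _ isClosed_conjSet hK
  refine ⟨s, ?_⟩
  rintro ⟨y, hy⟩
  have : y ∈ (Set.univ : Set SO8) ∩ ⋂ h ∈ s, {y : SO8 | famW h = y * famV h * y⁻¹} :=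
    ⟨Set.mem_univ _, Set.mem_iInter₂.2 fun h hh => hy h hh⟩
  rw [hs] at this
  exact this

end Sengupta

/-! ## §4 Consequences: trace words in EVERY representation fail; the shape of [Levy2004] Prop. 3.4 fails for `SO(8)` -/

section AllRepresentations

/-- Words commute with group homomorphisms: `w(f ∘ V) = f(w(V))`. [folklore] -/
private theorem wordVal_comp_hom {G H : Type*} [Group G] [Group H] (f : G →* H) {ι : Type*} (w : List (ι × Bool))
    (V : ι → G) : wordVal w (f ∘ V) = f (wordVal w V) := by
  induction w with
  | nil => simp
  | cons a w ih =>
    rw [wordVal_cons, wordVal_cons, map_mul, ih]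
    rcases a with ⟨i, _ | _⟩ <;> simp [letterVal]

/-- Every WORD in the restricted families is conjugate in `SO(8)` (words in `V ∘ g` are images `Ad(w)` of words in
`U(3)`, words in `W ∘ g` their `Q`-conjugates). [cite: Levy2004, Prop 3.4 (hypothesis); Sikora2017, §2] -/
theorem exists_wordVal_conj {ι : Type*} (g : ι → U3) (w : List (ι × Bool)) :
    ∃ y : SO8, wordVal w (famW ∘ g) = y * wordVal w (famV ∘ g) * y⁻¹ := by
  have hV : wordVal w (famV ∘ g) = famV (wordVal w g) := by
    rw [famV, wordVal_comp_hom]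
  have hW : wordVal w (famW ∘ g) = famW (wordVal w g) := by
    change wordVal w ((conjQ.comp adSO8) ∘ g) = (conjQ.comp adSO8) (wordVal w g)
    rw [wordVal_comp_hom]
  rw [hV, hW]
  exact exists_conj_eq _

/-- **EQUAL WORD TRACES IN EVERY REPRESENTATION**: for every homomorphism `ρ : SO(8) →* M_N(ℂ)` (any `N`; continuity is
not needed) and every index map `g`, the families `V ∘ g`, `W ∘ g` have `Re/Im tr ρ(w(V∘g)) = Re/Im tr ρ(w(W∘g))` for
every word `w` (conjugate elements have equal characters: the tree's `tracePart_conj`, module XX) — so no family of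
class functions of the words, in particular no family of Wilson loops in any representations, distinguishes them. [cite: Sikora2017, Thm «undisting» («undistinguishable by the generalized trace functions»)] -/
theorem tracePart_wordVal_eq {N : ℕ} (ρ : SO8 →* Matrix (Fin N) (Fin N) ℂ) {ι : Type*} (g : ι → U3)
    (w : List (ι × Bool)) (b : Bool) : tracePart ρ b (wordVal w (famV ∘ g)) = tracePart ρ b (wordVal w (famW ∘ g)) := by
  obtain ⟨y, hy⟩ := exists_wordVal_conj g w
  rw [hy, tracePart_conj]

/-- **`¬ TraceWordsSeparateOrbits ρ` FOR EVERY FINITE-DIMENSIONAL REPRESENTATION `ρ` OF `SO(8)`** — module XXI's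
orbit-separation schema fails for `SO(8)` not only in the natural representation (p340120) but in ALL representations,
and for all of them with the SAME finite pair of families. [cite: Sikora2017, Thm «undisting»; Levy2004, Prop 3.4 (SO(n) clause, contradicted at n = 8)] -/
theorem not_traceWordsSeparateOrbits_specialOrthogonalGroup_eight {N : ℕ}
    (ρ : Matrix.specialOrthogonalGroup (Fin 8) ℝ →* Matrix (Fin N) (Fin N) ℂ) : ¬ TraceWordsSeparateOrbits ρ := by
  intro hsep
  obtain ⟨s, hs⟩ := exists_finset_not_simultaneous_conj
  have h := hsep (↥s) (famV ∘ Subtype.val) (famW ∘ Subtype.val) fun w b => tracePart_wordVal_eq ρ Subtype.val w b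
  obtain ⟨y, hy⟩ := h
  exact hs ⟨y, fun h hh => hy ⟨h, hh⟩⟩

/-- In particular for the NATURAL (standard) representation of `SO(8)` — the `N = 8` case of the lineage's
`not_traceWordsSeparateOrbits_specialOrthogonalGroup_even` (p340120), by a different witness. [cite: AslaksenTanZhu1995, Thm 3 (SO(2k): traces alone do not generate)] -/
theorem not_traceWordsSeparateOrbits_specialOrthogonalRep_eight :
    ¬ TraceWordsSeparateOrbits (specialOrthogonalRep (Fin 8)) :=
  not_traceWordsSeparateOrbits_specialOrthogonalGroup_eight _

/-- **THE SHAPE OF [Levy2004] PROPOSITION 3.4 FAILS FOR `G = SO(8)`**: there are `r` and `g, g' ∈ SO(8)^r` such that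
`w(g)` and `w(g')` are conjugate in `SO(8)` for EVERY word `w` in `r` letters and their inverses, while `g` and `g'` do
NOT lie in the same diagonal conjugacy class.  (By [Levy2004] Prop. 3.6, Prop. 3.4 for `G` is equivalent to the density
of the Wilson-loop algebra — all representations — on every graph, Thm 3.1; the printed list of Thm 3.1 / Prop. 3.4
includes `SO(n)` for all `n`.) [cite: Levy2004, Prop 3.4 and Thm 3.1 (SO(n) clause; here refuted at n = 8); Sikora2017, Thm «undisting»] -/
theorem exists_wordwise_conj_not_simultaneous_conj :
    ∃ (r : ℕ) (g g' : Fin r → Matrix.specialOrthogonalGroup (Fin 8) ℝ),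
      (∀ w : List (Fin r × Bool), IsConj (wordVal w g) (wordVal w g')) ∧
        ¬ ∃ k : Matrix.specialOrthogonalGroup (Fin 8) ℝ, ∀ i, g' i = k * g i * k⁻¹ := by
  obtain ⟨s, hs⟩ := exists_finset_not_simultaneous_conj
  let e : Fin s.card ≃ ↥s := s.equivFin.symm
  refine ⟨s.card, famV ∘ Subtype.val ∘ e, famW ∘ Subtype.val ∘ e, fun w => ?_, ?_⟩
  · obtain ⟨y, hy⟩ := exists_wordVal_conj (Subtype.val ∘ e) w
    exact isConj_iff.2 ⟨y, hy.symm⟩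
  · rintro ⟨k, hk⟩
    refine hs ⟨k, fun h hh => ?_⟩
    have := hk (e.symm ⟨h, hh⟩)
    simpa [e] using this

end AllRepresentations

end Literature.MathematicalPhysics.QuantumFieldTheory.Balaban1983to89.WilsonLoopsNotCompleteSO8
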